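import Summits.Ventures.Crystal3D.Theorems.StickyWulffConstantNoReconstructionGainGrainFrameSplB
import Summits.Ventures.Crystal3D.Theorems.StickyWulffConstantNoReconstructionGainGrainFrameCaps
import HarnessLib

/-!
# The three-contact cap budget above the second depth: packaging and depth lemmas (pure real arithmetic)

HONEST FRAMING. Part of the venture `Summits/Ventures/Crystal3D` (cell `crystal3d-full`), helper
`--supports` the crux `NoReconstructionGain` (stmt-Ventures-19144, route
`route-Ventures-StickyWulffConstant`), line `adhesion` (wulff-p1 g12); a brick of the open stub
`stub_frameCapBudget` (skeleton v15), case of three substrate contacts, regime `2t > a+c` (every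
contact is strictly deeper than `d₂`, so the single-point lemma `spl2_coords` of `…GrainFrameSplB`
applies to each).

Coordinates and the credit interface `Cr` (keyed by integer lattice coordinates `(k,i,j)`, cubic sign
vector `(i+j, k+i, k+j)`) as in `…GrainFrameThreeRegimeI`.

* `mk3_of_pairs` — two credited pairs that are not the same pair give three distinct credits.
* `spl2_pack` — `spl2_coords` packaged: a non-vertex contact deeper than `d₂` blocks a credited pair
  `q ≠ q'` (returned as integer triples with the blocking inequalities).
* `high_vertex_step` — if one contact IS the vertex `d₁` (credited), any other contact blocks two
  credited directions other than `d₁`.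
* depth lemmas pinning the weak cells of the eight edges: `z_gt_one_of_T25`, `z_gt_one_of_T45`,
  `z_gt_one_of_mirror`, `qcellY_sum_nonneg` (mirror plane), `qcellX_sum_nonneg`, `qcellNegX_false`.

WHAT THIS IS NOT: the eight-edge analysis itself (next file); rung F-C1 not moved.
-/

namespace Summit.Ventures.Crystal3D.Theorems

/-- Two credited pairs `{e, e'}`, `{q, q'}` with `{q, q'} ≠ {e, e'}` (witnessed by a predicate `B`
holding on `q, q'` but not on both `e, e'`) give three distinct credited elements. -/
theorem mk3_of_pairs {α : Type*} [DecidableEq α] {Cr B : α → Prop} {e e' q q' : α}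
    (hee : e ≠ e') (hqq : q ≠ q') (Ce : Cr e) (Ce' : Cr e') (Cq : Cr q) (Cq' : Cr q')
    (Bq : B q) (Bq' : B q') (hB : ¬(B e ∧ B e')) :
    ∃ q₁ q₂ q₃ : α, q₁ ≠ q₂ ∧ q₁ ≠ q₃ ∧ q₂ ≠ q₃ ∧ Cr q₁ ∧ Cr q₂ ∧ Cr q₃ := by
  by_cases h1 : q = e ∨ q = e'
  · by_cases h2 : q' = e ∨ q' = e'
    · exfalso
      rcases h1 with rfl | rfl <;> rcases h2 with rfl | rfl
      · exact hqq rfl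
      · exact hB ⟨Bq, Bq'⟩
      · exact hB ⟨Bq', Bq⟩
      · exact hqq rfl
    · push Not at h2
      exact ⟨e, e', q', hee, fun h => h2.1 h.symm, fun h => h2.2 h.symm, Ce, Ce', Cq'⟩
  · push Not at h1
    exact ⟨e, e', q, hee, fun h => h1.1 h.symm, fun h => h1.2 h.symm, Ce, Ce', Cq⟩

section pack
variable {a b c x y z : ℝ} {Cr : ℤ × ℤ × ℤ → Prop}
  (ha : 0 ≤ a) (hab : a ≤ b) (hbc : b ≤ c) (hS : a ^ 2 + b ^ 2 + c ^ 2 = 2)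
  (hu : x ^ 2 + y ^ 2 + z ^ 2 = 2) (hdc : a + c < a * x + b * y + c * z)
  (hCrq : ∀ (k i j : ℤ) (e₁ e₂ e₃ : ℝ), e₁ = i + j → e₂ = k + i → e₃ = k + j →
    i ^ 2 + j ^ 2 + k ^ 2 + i * j + i * k + j * k = 1 → 0 < e₁ * a + e₂ * b + e₃ * c →
    1 < e₁ * x + e₂ * y + e₃ * z → Cr (k, i, j))
include ha hab hbc hS hu hdc hCrq

set_option maxHeartbeats 400000 in
/-- **`spl2_coords` packaged:** a contact strictly deeper than `d₂`, other than the vertex `d₁`, blocks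
two distinct credited directions (returned with the blocking inequalities in the integer key). -/
theorem spl2_pack (hne : ¬(x = 0 ∧ y = 1 ∧ z = 1)) :
    ∃ q q' : ℤ × ℤ × ℤ, q ≠ q' ∧ Cr q ∧ Cr q' ∧
      1 < ((q.2.1 : ℝ) + q.2.2) * x + ((q.1 : ℝ) + q.2.1) * y + ((q.1 : ℝ) + q.2.2) * z ∧
      1 < ((q'.2.1 : ℝ) + q'.2.2) * x + ((q'.1 : ℝ) + q'.2.1) * y + ((q'.1 : ℝ) + q'.2.2) * z := by
  have hc : 0 < c := by nlinarith
  have cD1 := hCrq 1 0 0 0 1 1 (by norm_num) (by norm_num) (by norm_num) (by norm_num) (by linarith)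
  have cD2 := hCrq 0 0 1 1 0 1 (by norm_num) (by norm_num) (by norm_num) (by norm_num) (by linarith)
  rcases spl2_coords ha hab hbc hS hu hdc hne with
    ⟨h1, h2⟩ | ⟨h1, h2, h3⟩ | ⟨h1, h2, h3⟩ | ⟨h1, h2, h3, h4⟩ | ⟨h1, h2, h3⟩ | ⟨h1, h2, h3⟩ | ⟨h1, h2, h3⟩ |
      ⟨h1, h2, h3, h4⟩
  · exact ⟨(1, 0, 0), (0, 0, 1), by decide, cD1 (by linarith), cD2 (by linarith),
      by push_cast; linarith, by push_cast; linarith⟩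
  · exact ⟨(1, 0, 0), (1, -1, 0), by decide, cD1 (by linarith),
      hCrq 1 (-1) 0 (-1) 0 1 (by norm_num) (by norm_num) (by norm_num) (by norm_num) (by linarith) (by linarith),
      by push_cast; linarith, by push_cast; linarith⟩
  · exact ⟨(0, 0, 1), (0, -1, 1), by decide, cD2 (by linarith),
      hCrq 0 (-1) 1 0 (-1) 1 (by norm_num) (by norm_num) (by norm_num) (by norm_num) (by linarith) (by linarith),
      by push_cast; linarith, by push_cast; linarith⟩
  · exact ⟨(1, -1, 0), (0, -1, 1), by decide,
      hCrq 1 (-1) 0 (-1) 0 1 (by norm_num) (by norm_num) (by norm_num) (by norm_num) (by linarith) (by linarith),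
      hCrq 0 (-1) 1 0 (-1) 1 (by norm_num) (by norm_num) (by norm_num) (by norm_num) (by linarith) (by linarith),
      by push_cast; linarith, by push_cast; linarith⟩
  · exact ⟨(1, 0, 0), (0, 1, 0), by decide, cD1 (by linarith),
      hCrq 0 1 0 1 1 0 (by norm_num) (by norm_num) (by norm_num) (by norm_num) (by linarith) (by linarith),
      by push_cast; linarith, by push_cast; linarith⟩
  · exact ⟨(1, 0, 0), (1, 0, -1), by decide, cD1 (by linarith),
      hCrq 1 0 (-1) (-1) 1 0 (by norm_num) (by norm_num) (by norm_num) (by norm_num) (by linarith) (by linarith),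
      by push_cast; linarith, by push_cast; linarith⟩
  · exact ⟨(0, 1, 0), (0, 0, 1), by decide,
      hCrq 0 1 0 1 1 0 (by norm_num) (by norm_num) (by norm_num) (by norm_num) (by linarith) (by linarith),
      cD2 (by linarith), by push_cast; linarith, by push_cast; linarith⟩
  · exact ⟨(1, 0, -1), (1, -1, 0), by decide,
      hCrq 1 0 (-1) (-1) 1 0 (by norm_num) (by norm_num) (by norm_num) (by norm_num) (by linarith) (by linarith),
      hCrq 1 (-1) 0 (-1) 0 1 (by norm_num) (by norm_num) (by norm_num) (by norm_num) (by linarith) (by linarith),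
      by push_cast; linarith, by push_cast; linarith⟩

omit hCrq in
/-- **The vertex step:** if the vertex `d₁` is credited (another contact IS `d₁`) then a contact deeper
than `d₂` that does not block `d₁` supplies two further distinct credits. -/
theorem high_vertex_step (hnb : y + z ≤ 1) (C1 : Cr (1, 0, 0))
    (hCrq : ∀ (k i j : ℤ) (e₁ e₂ e₃ : ℝ), e₁ = i + j → e₂ = k + i → e₃ = k + j →
      i ^ 2 + j ^ 2 + k ^ 2 + i * j + i * k + j * k = 1 → 0 < e₁ * a + e₂ * b + e₃ * c →
      1 < e₁ * x + e₂ * y + e₃ * z → Cr (k, i, j)) :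
    ∃ q₁ q₂ q₃ : ℤ × ℤ × ℤ, q₁ ≠ q₂ ∧ q₁ ≠ q₃ ∧ q₂ ≠ q₃ ∧ Cr q₁ ∧ Cr q₂ ∧ Cr q₃ := by
  have hc : 0 < c := by nlinarith
  have hne : ¬(x = 0 ∧ y = 1 ∧ z = 1) := by rintro ⟨-, rfl, rfl⟩; linarith
  have cD2 := hCrq 0 0 1 1 0 1 (by norm_num) (by norm_num) (by norm_num) (by norm_num) (by linarith)
  rcases spl2_coords ha hab hbc hS hu hdc hne with
    ⟨h1, h2⟩ | ⟨h1, h2, h3⟩ | ⟨h1, h2, h3⟩ | ⟨h1, h2, h3, h4⟩ | ⟨h1, h2, h3⟩ | ⟨h1, h2, h3⟩ | ⟨h1, h2, h3⟩ |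
      ⟨h1, h2, h3, h4⟩
  · linarith
  · linarith
  · exact ⟨(1, 0, 0), (0, 0, 1), (0, -1, 1), by decide, by decide, by decide, C1, cD2 (by linarith),
      hCrq 0 (-1) 1 0 (-1) 1 (by norm_num) (by norm_num) (by norm_num) (by norm_num) (by linarith) (by linarith)⟩
  · exact ⟨(1, 0, 0), (1, -1, 0), (0, -1, 1), by decide, by decide, by decide, C1,
      hCrq 1 (-1) 0 (-1) 0 1 (by norm_num) (by norm_num) (by norm_num) (by norm_num) (by linarith) (by linarith),
      hCrq 0 (-1) 1 0 (-1) 1 (by norm_num) (by norm_num) (by norm_num) (by norm_num) (by linarith) (by linarith)⟩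
  · linarith
  · linarith
  · exact ⟨(1, 0, 0), (0, 1, 0), (0, 0, 1), by decide, by decide, by decide, C1,
      hCrq 0 1 0 1 1 0 (by norm_num) (by norm_num) (by norm_num) (by norm_num) (by linarith) (by linarith),
      cD2 (by linarith)⟩
  · exact ⟨(1, 0, 0), (1, 0, -1), (1, -1, 0), by decide, by decide, by decide, C1,
      hCrq 1 0 (-1) (-1) 1 0 (by norm_num) (by norm_num) (by norm_num) (by norm_num) (by linarith) (by linarith),
      hCrq 1 (-1) 0 (-1) 0 1 (by norm_num) (by norm_num) (by norm_num) (by norm_num) (by linarith) (by linarith)⟩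

end pack

/-! ## Depth lemmas for the weak cells of the eight edges -/

/-- Edge `d₂d₅`: a contact deeper than `d₂` blocking `−d₆` and not `d₃` has `z > 1`. -/
theorem z_gt_one_of_T25 {a b c x y z : ℝ} (ha : 0 ≤ a) (hab : a ≤ b) (hc : 0 < c)
    (hdc : a + c < a * x + b * y + c * z) (n3 : x + y ≤ 1) (hn6 : 1 < x - y) : 1 < z := by
  rcases lt_or_ge y 0 with hy | hy
  · have hby : b * y ≤ a * y := by nlinarith
    have h1 : a * (x + y - 1) ≤ 0 := by nlinarith
    nlinarith
  · linarith

/-- Edge `d₄d₅`: a contact deeper than `d₂` blocking `d₄` and `d₅` has `z > 1`. -/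
theorem z_gt_one_of_T45 {a b c x y z : ℝ} (ha : 0 ≤ a) (hab : a ≤ b) (hc : 0 < c)
    (hdc : a + c < a * x + b * y + c * z) (h4 : 1 < z - x) (h5 : 1 < z - y) : 1 < z := by
  rcases lt_or_ge 0 x with hx | hx
  · linarith
  rcases lt_or_ge 0 y with hy | hy
  · linarith
  have h1 : a * x ≤ 0 := by nlinarith
  have h2 : b * y ≤ 0 := by nlinarith
  nlinarith

/-- Mirror plane `a = b`: a contact deeper than `d₂` not blocking `d₃` has `z > 1`. -/
theorem z_gt_one_of_mirror {a c x y z : ℝ} (ha : 0 ≤ a) (hc : 0 < c)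
    (hdc : a + c < a * x + a * y + c * z) (n3 : x + y ≤ 1) : 1 < z := by
  have h1 : a * (x + y) ≤ a := by nlinarith
  nlinarith

/-- No contact is deeper than `d₂` when `a = b = 0` unless `z > 1`. -/
theorem z_gt_one_of_axis {a b c x y z : ℝ} (ha : 0 ≤ a) (hab : a ≤ b) (hab0 : a + b ≤ 0) (hc : 0 < c)
    (hdc : a + c < a * x + b * y + c * z) : 1 < z := by
  have ha0 : a = 0 := by linarith
  have hb0 : b = 0 := by linarith
  subst ha0; subst hb0
  nlinarith

/-- Mirror plane `a = b`, edge `d₁d₃`: a contact deeper than `d₂` in the centre cell of the square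
about `+y` (blocking `d₁, d₃, −d₅`) has `x + z ≥ 0`. -/
theorem qcellY_sum_nonneg {a c x y z : ℝ} (ha : 0 ≤ a) (hac : a ≤ c)
    (hu : x ^ 2 + y ^ 2 + z ^ 2 = 2) (hdc : a + c < a * x + a * y + c * z)
    (h1 : 1 < y + z) (h3 : 1 < x + y) (hn5 : 1 < y - z) : 0 ≤ x + z := by
  by_contra h; push Not at h
  have hy2 : y < 2 := by nlinarith [sq_nonneg x, sq_nonneg z]
  rcases le_or_gt 0 x with hx | hx
  · -- `z < -x ≤ 0`
    have hcz : c * z < -(c * x) := by nlinarith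
    have hax : (a - c) * x ≤ 0 := by nlinarith
    have hay : a * y ≤ 2 * a := by nlinarith
    nlinarith
  · -- `x < 0`, `-x < y - 1`
    have hcz : c * z < -(c * x) := by nlinarith
    have h2 : (c - a) * (-x) ≤ (c - a) * (y - 1) := by nlinarith
    nlinarith

/-- Edge `d₂d₃`: a contact deeper than `d₁` in the centre cell of the square about `+x` (blocking
`d₂, d₃, −d₄`) has `y + z ≥ 0`. -/
theorem qcellX_sum_nonneg {a b c x y z : ℝ} (ha : 0 ≤ a) (hab : a ≤ b) (hbc : b ≤ c)
    (hu : x ^ 2 + y ^ 2 + z ^ 2 = 2) (hdc : b + c < a * x + b * y + c * z)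
    (h2 : 1 < x + z) (h3 : 1 < x + y) (hn4 : 1 < x - z) : 0 ≤ y + z := by
  by_contra h; push Not at h
  have hx0 : 0 < x := by linarith
  have hx32 : x < 3 / 2 := by nlinarith [sq_nonneg y, sq_nonneg z]
  have h1 : b * (y + z) ≤ 0 := by nlinarith
  have h2' : (c - b) * z ≤ (c - b) * (x - 1) := by nlinarith
  have hδ : a * x + b * y + c * z ≤ (a + c - b) * (x - 1) + a := by nlinarith
  have h3' : (a + c - b) * (x - 1) ≤ (a + c - b) * (1 / 2) := by nlinarith
  nlinarith

/-- Edge `d₄d₆`: no contact deeper than `d₁` lies in the centre cell of the square about `−x`. -/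
theorem qcellNegX_false {a b c x y z : ℝ} (ha : 0 ≤ a) (hb : 0 ≤ b) (hc : 0 < c)
    (hu : x ^ 2 + y ^ 2 + z ^ 2 = 2) (hdc : b + c < a * x + b * y + c * z)
    (h6 : 1 < y - x) (hn3 : 1 < -x - y) (hn2 : 1 < -x - z) : False := by
  have hx : x < -1 := by
    rcases le_or_gt 0 y with hy | hy <;> linarith
  have hx2 : 1 < x ^ 2 := by nlinarith
  have hy1 : y < 1 := by nlinarith [sq_nonneg z]
  have hz1 : z < 1 := by nlinarith [sq_nonneg y]
  have h1 : a * x ≤ 0 := by nlinarith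
  have h2 : b * y ≤ b := by nlinarith
  have h3 : c * z < c := by nlinarith
  linarith

end Summit.Ventures.Crystal3D.Theorems
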